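import Summits.Ventures.WeilGRH.ReflectionPrelims
import Literature.Analysis.FluidPDE.Wei2016HardyLemma
import HarnessLib

/-!
# GRH arm (rh-explicit, venture WeilGRH): the reflection inequality with a second prime inside

Two-prime version of `ReflectionInequality.lean` (`reflection_inequality`, the case `δ = 0`,
`a < log 2`). On a window `[-a, a]` with `log 3 ≤ 2a ≤ 2 log 2` the prime powers `n = 2` AND
`n = 3` enter the explicit formula of `k = g ⋆ g̃`; write `L = log 2`, `L₃ = log 3`, `m = L − a ≥ 0`,
`m₃ = L₃ − a ≥ m`. The prime `2` is treated by the reflection of `ReflectionInequality.lean`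
(fold `[-a,-m]` onto `[m,a]`, reflected pair `ωg(x) ± g(x − L)`, weighted AM–GM, optimisation in the
weight), but with the budget on the folded window `[m, a]` lowered from `B` to `B − δ`; the prime `3`
is then paid for out of `δ`, through the crude bound

`2|k(L₃)| ≤ ∫_{m₃}^{a}|g|² + ∫_{-a}^{-m₃}|g|² ≤ S := ∫_m^a |g|² + ∫_{-a}^{-m} |g|²`

(`k(L₃) = ∫_{m₃}^{a} g(x) conj g(x − L₃) dx`, `2|uv| ≤ |u|² + |v|²`, `m ≤ m₃`). For a unit `ω`, `0 ≤ κ`,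
`0 ≤ δ`, `κ + δ < B`:

`|c|² ≤ (B‖g‖₂² − δS + 2κ Re(ω k(L))) · G_δ`,
`G_δ = C_M/B + (C_A + Re ω·I_A)/(B − δ + κ) + (C_A − Re ω·I_A)/(B − δ − κ)`,

with `c = ∫ g cosh(x/2)`, the same closed forms `C_M, C_A, I_A` as in the one-prime file, and an
`S ≥ 2|k(L₃)|`. Here `a = log 2` (`m = 0`) is allowed.

References: A. Weil (1952), (11) and the «lemme» p. 262; H. Yoshida (1992) §6 (polar bookkeeping).
-/

noncomputable section

open Complex Filter Set MeasureTheory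
open scoped Real Topology ComplexConjugate ArithmeticFunction.vonMangoldt

namespace Summit.Ventures.WeilGRH

open Literature.NumberTheory.LFunctions

variable {g : ℝ → ℂ}

/-! ## The two-prime reflection inequality -/

/-- **The two-prime reflection inequality.** Let `g` be a test function supported in `[-a, a]`
with `log 3 ≤ 2a`, `a ≤ log 2`; put `L = log 2`, `m = L − a`, `L₃ = log 3`, let `ω` be a unit
complex number and `0 ≤ κ`, `0 ≤ δ`, `κ + δ < B`. Then there is `S` with `2|k(L₃)| ≤ S` and

`|c|² ≤ (B·N − δS + 2κ·Re(ω k(L))) · (C_M/B + (C_A + Re ω·I_A)/(B−δ+κ) + (C_A − Re ω·I_A)/(B−δ−κ))`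

(`c = ∫ g cosh(x/2)`, `k = g ⋆ g̃`, `N = ‖g‖₂²`, closed forms as in `reflection_inequality`).
Proof: as `reflection_inequality` with the weights `λB, λ(B − δ ± κ)`, and `S = ∫_m^a|g|² + ∫_{-a}^{-m}|g|²`
(`2|g(x)||g(x−L₃)| ≤ |g(x)|² + |g(x−L₃)|²` on `[m₃, a] ⊆ [m, a]`). [folklore] -/
theorem reflection_inequality_two_prime (hg : IsWeilTest g) {a : ℝ}
    (hsupp : tsupport g ⊆ Icc (-a) a) (ha3 : Real.log 3 ≤ 2 * a) (ha2 : a ≤ Real.log 2)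
    {ω : ℂ} (hω : ‖ω‖ = 1) {κ δ B : ℝ} (hκ : 0 ≤ κ) (hδ : 0 ≤ δ) (hκB : κ + δ < B)
    {m CM CA IA : ℝ} (hm : m = Real.log 2 - a) (hCM : CM = Real.sinh m + m)
    (hCA : CA = (Real.sinh a - Real.sinh m + (a - m)) / 2)
    (hIA : IA = (a - m) * Real.cosh (Real.log 2 / 2) / 2 + Real.sinh (a - Real.log 2 / 2)) :
    ∃ S : ℝ, 2 * ‖weilConv g (weilReflect g) (Real.log 3)‖ ≤ S ∧
    0 ≤ B * (∫ x, ‖g x‖ ^ 2) - δ * S + 2 * κ * (ω * weilConv g (weilReflect g) (Real.log 2)).re ∧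
    ‖∫ x, g x * (Real.cosh (x / 2) : ℂ)‖ ^ 2 ≤
      (B * (∫ x, ‖g x‖ ^ 2) - δ * S + 2 * κ * (ω * weilConv g (weilReflect g) (Real.log 2)).re) *
        (CM / B + (CA + ω.re * IA) / (B - δ + κ) + (CA - ω.re * IA) / (B - δ - κ)) := by
  set L := Real.log 2 with hL
  set B' : ℝ := B - δ with hB'
  have hlog23 : Real.log 2 < Real.log 3 := Real.log_lt_log (by norm_num) (by norm_num)
  have ha1 : Real.log 2 < 2 * a := by linarith
  have hm0 : 0 ≤ m := by rw [hm]; linarith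
  have hma : m < a := by rw [hm]; linarith
  have hma' : m ≤ a := hma.le
  have hmm : -m ≤ m := by linarith
  have hB : 0 < B := by linarith
  have hBp : 0 < B' + κ := by rw [hB']; linarith
  have hBm : 0 < B' - κ := by rw [hB']; linarith
  -- support and continuity
  have hgc : Continuous g := hg.1.continuous
  have hz : ∀ x, x ∉ Icc (-a) a → g x = 0 := fun x hx ↦
    image_eq_zero_of_notMem_tsupport fun h ↦ hx (hsupp h)
  have hgL : Continuous fun x ↦ g (x - L) := hgc.comp (continuous_id.sub continuous_const)
  have hcont_f : Continuous fun x ↦ g x * (Real.cosh (x / 2) : ℂ) := by fun_prop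
  have hii : ∀ u v : ℝ, IntervalIntegrable (fun x ↦ g x * (Real.cosh (x / 2) : ℂ)) volume u v :=
    fun u v ↦ hcont_f.intervalIntegrable u v
  -- the reflected pair and the kernels
  set Ψp : ℝ → ℂ := fun x ↦ ω * g x + g (x - L) with hΨp
  set Ψm : ℝ → ℂ := fun x ↦ ω * g x - g (x - L) with hΨm
  set ηp : ℝ → ℂ := fun x ↦ conj ω * (Real.cosh (x / 2) : ℂ) + (Real.cosh ((L - x) / 2) : ℂ)
    with hηp
  set ηm : ℝ → ℂ := fun x ↦ conj ω * (Real.cosh (x / 2) : ℂ) - (Real.cosh ((L - x) / 2) : ℂ)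
    with hηm
  have hΨpc : Continuous Ψp := by rw [hΨp]; fun_prop
  have hΨmc : Continuous Ψm := by rw [hΨm]; fun_prop
  have hηpc : Continuous ηp := by rw [hηp]; fun_prop
  have hηmc : Continuous ηm := by rw [hηm]; fun_prop
  -- the real integrals entering `W` and `G`
  set NM : ℝ := ∫ x in (-m)..m, ‖g x‖ ^ 2 with hNM
  set NA : ℝ := ∫ x in m..a, ‖g x‖ ^ 2 with hNA
  set NA' : ℝ := ∫ x in m..a, ‖g (x - L)‖ ^ 2 with hNA'
  set Yp : ℝ := ∫ x in m..a, ‖Ψp x‖ ^ 2 with hYp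
  set Ym : ℝ := ∫ x in m..a, ‖Ψm x‖ ^ 2 with hYm
  set Ep : ℝ := ∫ x in m..a, ‖ηp x‖ ^ 2 with hEp
  set Em : ℝ := ∫ x in m..a, ‖ηm x‖ ^ 2 with hEm
  set CM' : ℝ := ∫ x in (-m)..m, Real.cosh (x / 2) ^ 2 with hCM'
  set KA : ℝ := ∫ x in m..a, (ω * (g x * conj (g (x - L)))).re with hKA
  have hNM0 : 0 ≤ NM := intervalIntegral.integral_nonneg hmm fun x _ ↦ by positivity
  have hYp0 : 0 ≤ Yp := intervalIntegral.integral_nonneg hma' fun x _ ↦ by positivity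
  have hYm0 : 0 ≤ Ym := intervalIntegral.integral_nonneg hma' fun x _ ↦ by positivity
  have hEp0 : 0 ≤ Ep := intervalIntegral.integral_nonneg hma' fun x _ ↦ by positivity
  have hEm0 : 0 ≤ Em := intervalIntegral.integral_nonneg hma' fun x _ ↦ by positivity
  have hCM'0 : 0 ≤ CM' := intervalIntegral.integral_nonneg hmm fun x _ ↦ by positivity
  set W : ℝ := B * NM + ((B' + κ) * Yp + (B' - κ) * Ym) / 2 with hW
  set G : ℝ := CM' / B + (Ep / (B' + κ) + Em / (B' - κ)) / 2 with hG
  have hW0 : 0 ≤ W := by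
    have h1 : 0 ≤ (B' + κ) * Yp := mul_nonneg hBp.le hYp0
    have h2 : 0 ≤ (B' - κ) * Ym := mul_nonneg hBm.le hYm0
    have h3 : 0 ≤ B * NM := mul_nonneg hB.le hNM0
    rw [hW]; linarith
  have hG0 : 0 ≤ G := by
    have h1 : 0 ≤ Ep / (B' + κ) := div_nonneg hEp0 hBp.le
    have h2 : 0 ≤ Em / (B' - κ) := div_nonneg hEm0 hBm.le
    have h3 : 0 ≤ CM' / B := div_nonneg hCM'0 hB.le
    rw [hG]; linarith
  /- Step 1: `c = ∫_{-m}^{m} g cosh(x/2) + ½ ∫_m^a (Ψ₊η₊ + Ψ₋η₋)`. -/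
  set c : ℂ := ∫ x, g x * (Real.cosh (x / 2) : ℂ) with hc
  have hc1 : c = ∫ x in (-a)..a, g x * (Real.cosh (x / 2) : ℂ) :=
    integral_eq_intervalIntegral_of_zero_off (by linarith) fun x hx ↦ by simp [hz x hx]
  have hsplit : c = (∫ x in (-a)..(-m), g x * (Real.cosh (x / 2) : ℂ)) +
      ((∫ x in (-m)..m, g x * (Real.cosh (x / 2) : ℂ)) +
        ∫ x in m..a, g x * (Real.cosh (x / 2) : ℂ)) := by
    rw [hc1, intervalIntegral.integral_add_adjacent_intervals (hii _ _) (hii _ _),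
      intervalIntegral.integral_add_adjacent_intervals (hii _ _) (hii _ _)]
  have hleft : ∫ x in (-a)..(-m), g x * (Real.cosh (x / 2) : ℂ) =
      ∫ x in m..a, g (x - L) * (Real.cosh ((L - x) / 2) : ℂ) := by
    have e2 : ∫ x in m..a, g (-x) * (Real.cosh (x / 2) : ℂ) =
        ∫ x in (-a)..(-m), g x * (Real.cosh (x / 2) : ℂ) := by
      rw [← intervalIntegral.integral_comp_neg fun x ↦ g x * (Real.cosh (x / 2) : ℂ)]
      refine intervalIntegral.integral_congr fun x _ ↦ ?_
      simp only [neg_div, Real.cosh_neg]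
    have e1 := intervalIntegral.integral_comp_sub_left
      (fun y ↦ g (-y) * (Real.cosh (y / 2) : ℂ)) L (a := m) (b := a)
    rw [show L - a = m by rw [hm], show L - m = a by rw [hm]; ring] at e1
    simp only [neg_sub] at e1
    rw [← e2, ← e1]
  have hfold : (∫ x in (-a)..(-m), g x * (Real.cosh (x / 2) : ℂ)) +
      (∫ x in m..a, g x * (Real.cosh (x / 2) : ℂ)) =
      ∫ x in m..a, (Ψp x * ηp x + Ψm x * ηm x) / 2 := by
    rw [hleft, ← intervalIntegral.integral_add ((by fun_prop : Continuous fun x ↦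
        g (x - L) * (Real.cosh ((L - x) / 2) : ℂ)).intervalIntegrable _ _) (hii _ _)]
    refine intervalIntegral.integral_congr fun x _ ↦ ?_
    simp only [hΨp, hΨm, hηp, hηm]
    rw [add_comm]
    exact reflectPair_fold hω _ _ _ _
  have hc2 : c = (∫ x in (-m)..m, g x * (Real.cosh (x / 2) : ℂ)) +
      ∫ x in m..a, (Ψp x * ηp x + Ψm x * ηm x) / 2 := by
    rw [hsplit, ← hfold]; ring
  /- Step 2: for every weight `l > 0`, `2|c| ≤ l·W + G/l`. -/
  have key : ∀ l : ℝ, 0 < l → 2 * ‖c‖ ≤ l * W + G / l := by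
    intro l hl
    have hμM : 0 < l * B := mul_pos hl hB
    have hμp : 0 < l * (B' + κ) := mul_pos hl hBp
    have hμm : 0 < l * (B' - κ) := mul_pos hl hBm
    -- middle window
    have h1 : ‖∫ x in (-m)..m, g x * (Real.cosh (x / 2) : ℂ)‖ ≤
        ∫ x in (-m)..m, ((l * B) * ‖g x‖ ^ 2 + Real.cosh (x / 2) ^ 2 / (l * B)) / 2 := by
      refine (intervalIntegral.norm_integral_le_integral_norm hmm).trans ?_
      refine intervalIntegral.integral_mono_on hmm (hcont_f.norm.intervalIntegrable _ _)
        ((by fun_prop : Continuous fun x ↦ ((l * B) * ‖g x‖ ^ 2 +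
          Real.cosh (x / 2) ^ 2 / (l * B)) / 2).intervalIntegrable _ _) fun x _ ↦ ?_
      rw [norm_mul, Complex.norm_real, Real.norm_eq_abs, abs_of_pos (Real.cosh_pos _)]
      have := two_mul_le_weighted (u := ‖g x‖) (v := Real.cosh (x / 2)) hμM
      linarith
    have h1' : ∫ x in (-m)..m, ((l * B) * ‖g x‖ ^ 2 + Real.cosh (x / 2) ^ 2 / (l * B)) / 2 =
        ((l * B) * NM + CM' / (l * B)) / 2 := by
      rw [intervalIntegral.integral_div, intervalIntegral.integral_add
          ((by fun_prop : Continuous fun x ↦ (l * B) * ‖g x‖ ^ 2).intervalIntegrable _ _)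
          ((by fun_prop : Continuous fun x ↦
            Real.cosh (x / 2) ^ 2 / (l * B)).intervalIntegrable _ _),
        intervalIntegral.integral_const_mul, intervalIntegral.integral_div]
    -- folded window
    have h2 : ‖∫ x in m..a, (Ψp x * ηp x + Ψm x * ηm x) / 2‖ ≤
        ∫ x in m..a, ((l * (B' + κ)) * ‖Ψp x‖ ^ 2 + ‖ηp x‖ ^ 2 / (l * (B' + κ)) +
          ((l * (B' - κ)) * ‖Ψm x‖ ^ 2 + ‖ηm x‖ ^ 2 / (l * (B' - κ)))) / 4 := by
      refine (intervalIntegral.norm_integral_le_integral_norm hma').trans ?_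
      refine intervalIntegral.integral_mono_on hma'
        ((by fun_prop : Continuous fun x ↦
          (Ψp x * ηp x + Ψm x * ηm x) / 2).norm.intervalIntegrable _ _)
        ((by fun_prop : Continuous fun x ↦ ((l * (B' + κ)) * ‖Ψp x‖ ^ 2 +
          ‖ηp x‖ ^ 2 / (l * (B' + κ)) + ((l * (B' - κ)) * ‖Ψm x‖ ^ 2 +
          ‖ηm x‖ ^ 2 / (l * (B' - κ)))) / 4).intervalIntegrable _ _) fun x _ ↦ ?_
      have hp := two_mul_le_weighted (u := ‖Ψp x‖) (v := ‖ηp x‖) hμp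
      have hq := two_mul_le_weighted (u := ‖Ψm x‖) (v := ‖ηm x‖) hμm
      have hn : ‖(Ψp x * ηp x + Ψm x * ηm x) / 2‖ ≤ (‖Ψp x‖ * ‖ηp x‖ + ‖Ψm x‖ * ‖ηm x‖) / 2 := by
        rw [norm_div, Complex.norm_two]
        refine div_le_div_of_nonneg_right ?_ (by norm_num)
        exact (norm_add_le _ _).trans (by rw [norm_mul, norm_mul])
      linarith
    have h2' : ∫ x in m..a, ((l * (B' + κ)) * ‖Ψp x‖ ^ 2 + ‖ηp x‖ ^ 2 / (l * (B' + κ)) +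
          ((l * (B' - κ)) * ‖Ψm x‖ ^ 2 + ‖ηm x‖ ^ 2 / (l * (B' - κ)))) / 4 =
        ((l * (B' + κ)) * Yp + Ep / (l * (B' + κ)) + ((l * (B' - κ)) * Ym + Em / (l * (B' - κ)))) / 4 := by
      have i1 : IntervalIntegrable (fun x ↦ (l * (B' + κ)) * ‖Ψp x‖ ^ 2) volume m a :=
        (by fun_prop : Continuous fun x ↦ (l * (B' + κ)) * ‖Ψp x‖ ^ 2).intervalIntegrable _ _
      have i2 : IntervalIntegrable (fun x ↦ ‖ηp x‖ ^ 2 / (l * (B' + κ))) volume m a :=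
        (by fun_prop : Continuous fun x ↦ ‖ηp x‖ ^ 2 / (l * (B' + κ))).intervalIntegrable _ _
      have i3 : IntervalIntegrable (fun x ↦ (l * (B' - κ)) * ‖Ψm x‖ ^ 2) volume m a :=
        (by fun_prop : Continuous fun x ↦ (l * (B' - κ)) * ‖Ψm x‖ ^ 2).intervalIntegrable _ _
      have i4 : IntervalIntegrable (fun x ↦ ‖ηm x‖ ^ 2 / (l * (B' - κ))) volume m a :=
        (by fun_prop : Continuous fun x ↦ ‖ηm x‖ ^ 2 / (l * (B' - κ))).intervalIntegrable _ _
      rw [intervalIntegral.integral_div, intervalIntegral.integral_add (i1.add i2) (i3.add i4),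
        intervalIntegral.integral_add i1 i2, intervalIntegral.integral_add i3 i4,
        intervalIntegral.integral_const_mul, intervalIntegral.integral_div,
        intervalIntegral.integral_const_mul, intervalIntegral.integral_div]
    have hcn : ‖c‖ ≤ ‖∫ x in (-m)..m, g x * (Real.cosh (x / 2) : ℂ)‖ +
        ‖∫ x in m..a, (Ψp x * ηp x + Ψm x * ηm x) / 2‖ := by
      rw [hc2]; exact norm_add_le _ _
    have htot : 2 * ‖c‖ ≤ ((l * B) * NM + CM' / (l * B)) +
        ((l * (B' + κ)) * Yp + Ep / (l * (B' + κ)) +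
          ((l * (B' - κ)) * Ym + Em / (l * (B' - κ)))) / 2 := by
      rw [h1'] at h1
      rw [h2'] at h2
      linarith
    have halg : ((l * B) * NM + CM' / (l * B)) +
        ((l * (B' + κ)) * Yp + Ep / (l * (B' + κ)) +
          ((l * (B' - κ)) * Ym + Em / (l * (B' - κ)))) / 2 = l * W + G / l := by
      rw [hW, hG]
      field_simp
      ring
    linarith
  /- Step 3: optimise in `l`. -/
  have hsq : ‖c‖ ^ 2 ≤ W * G :=
    Literature.Analysis.FluidPDE.Wei2016.sq_le_mul_of_forall_two_mul_le (norm_nonneg _) hW0 hG0 key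
  /- Step 4: identify `W` and `G`. -/
  -- `N = NA' + NM + NA`
  have hN : ∫ x, ‖g x‖ ^ 2 = NA' + (NM + NA) := by
    have hii2 : ∀ u v : ℝ, IntervalIntegrable (fun x ↦ ‖g x‖ ^ 2) volume u v :=
      fun u v ↦ (hgc.norm.pow 2).intervalIntegrable u v
    rw [integral_eq_intervalIntegral_of_zero_off (lo := -a) (hi := a) (by linarith)
        (fun x hx ↦ by simp [hz x hx]),
      ← intervalIntegral.integral_add_adjacent_intervals (hii2 (-a) (-m)) (hii2 (-m) a),
      ← intervalIntegral.integral_add_adjacent_intervals (hii2 (-m) m) (hii2 m a), hNA']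
    congr 1
    rw [intervalIntegral.integral_comp_sub_right (fun x ↦ ‖g x‖ ^ 2) L,
      show m - L = -a by rw [hm]; ring, show a - L = -m by rw [hm]; ring]
  have hNA'eq : NA' = ∫ x in (-a)..(-m), ‖g x‖ ^ 2 := by
    rw [hNA', intervalIntegral.integral_comp_sub_right (fun x ↦ ‖g x‖ ^ 2) L,
      show m - L = -a by rw [hm]; ring, show a - L = -m by rw [hm]; ring]
  have hNA0 : 0 ≤ NA := intervalIntegral.integral_nonneg hma' fun x _ ↦ by positivity
  have hNA'0 : 0 ≤ NA' := intervalIntegral.integral_nonneg hma' fun x _ ↦ by positivity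
  /- Step 4b: the crude bound for the prime `3`: `2|k(L₃)| ≤ NA + NA'`. -/
  set L₃ := Real.log 3 with hL₃
  set m₃ : ℝ := L₃ - a with hm₃
  have hm₃a : m₃ ≤ a := by rw [hm₃]; linarith
  have hmm₃ : m ≤ m₃ := by rw [hm, hm₃]; linarith
  have hgL₃ : Continuous fun x ↦ g (x - L₃) := hgc.comp (continuous_id.sub continuous_const)
  have hk3 : 2 * ‖weilConv g (weilReflect g) L₃‖ ≤ NA + NA' := by
    have hii2 : ∀ u v : ℝ, IntervalIntegrable (fun x ↦ ‖g x‖ ^ 2) volume u v :=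
      fun u v ↦ (hgc.norm.pow 2).intervalIntegrable u v
    have hkint : weilConv g (weilReflect g) L₃ = ∫ x in m₃..a, g x * conj (g (x - L₃)) := by
      rw [weilConv_weilReflect_apply_eq]
      refine integral_eq_intervalIntegral_of_zero_off hm₃a fun x hx ↦ ?_
      rw [mem_Icc, not_and_or, not_le, not_le] at hx
      rcases hx with hx | hx
      · have : g (x - L₃) = 0 := hz _ fun h ↦ by
          rw [mem_Icc] at h
          have : L₃ - a = m₃ := by rw [hm₃]
          linarith [h.1]
        simp [this]
      · have : g x = 0 := hz _ fun h ↦ by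
          rw [mem_Icc] at h
          linarith [h.2]
        simp [this]
    have h1 : ‖weilConv g (weilReflect g) L₃‖ ≤
        ∫ x in m₃..a, (‖g x‖ ^ 2 + ‖g (x - L₃)‖ ^ 2) / 2 := by
      rw [hkint]
      refine (intervalIntegral.norm_integral_le_integral_norm hm₃a).trans ?_
      refine intervalIntegral.integral_mono_on hm₃a
        ((by fun_prop : Continuous fun x ↦ g x * conj (g (x - L₃))).norm.intervalIntegrable _ _)
        ((by fun_prop : Continuous fun x ↦
          (‖g x‖ ^ 2 + ‖g (x - L₃)‖ ^ 2) / 2).intervalIntegrable _ _) fun x _ ↦ ?_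
      rw [norm_mul, Complex.norm_conj]
      have hsq := two_mul_le_add_sq ‖g x‖ ‖g (x - L₃)‖
      linarith only [hsq]
    have i3 : IntervalIntegrable (fun x ↦ ‖g (x - L₃)‖ ^ 2) volume m₃ a :=
      (hgL₃.norm.pow 2).intervalIntegrable _ _
    have h2 : ∫ x in m₃..a, (‖g x‖ ^ 2 + ‖g (x - L₃)‖ ^ 2) / 2 =
        ((∫ x in m₃..a, ‖g x‖ ^ 2) + ∫ x in (-a)..(-m₃), ‖g x‖ ^ 2) / 2 := by
      rw [intervalIntegral.integral_div, intervalIntegral.integral_add (hii2 _ _) i3,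
        intervalIntegral.integral_comp_sub_right (fun x ↦ ‖g x‖ ^ 2) L₃,
        show m₃ - L₃ = -a by rw [hm₃]; ring, show a - L₃ = -m₃ by rw [hm₃]; ring]
    have h3 : ∫ x in m₃..a, ‖g x‖ ^ 2 ≤ NA := by
      have h0 : 0 ≤ ∫ x in m..m₃, ‖g x‖ ^ 2 :=
        intervalIntegral.integral_nonneg hmm₃ fun x _ ↦ by positivity
      have hs := intervalIntegral.integral_add_adjacent_intervals (hii2 m m₃) (hii2 m₃ a)
      rw [hNA]
      linarith only [h0, hs]
    have h4 : ∫ x in (-a)..(-m₃), ‖g x‖ ^ 2 ≤ NA' := by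
      have hle : -m₃ ≤ -m := by linarith only [hmm₃]
      have h0 : 0 ≤ ∫ x in (-m₃)..(-m), ‖g x‖ ^ 2 :=
        intervalIntegral.integral_nonneg hle fun x _ ↦ by positivity
      have hs := intervalIntegral.integral_add_adjacent_intervals (hii2 (-a) (-m₃)) (hii2 (-m₃) (-m))
      rw [hNA'eq]
      linarith only [h0, hs]
    linarith only [h1, h2, h3, h4]
  -- `Yp + Ym = 2 (NA + NA')`, `Yp - Ym = 4 KA`
  have iYp : IntervalIntegrable (fun x ↦ ‖Ψp x‖ ^ 2) volume m a := (hΨpc.norm.pow 2).intervalIntegrable _ _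
  have iYm : IntervalIntegrable (fun x ↦ ‖Ψm x‖ ^ 2) volume m a := (hΨmc.norm.pow 2).intervalIntegrable _ _
  have iNA : IntervalIntegrable (fun x ↦ ‖g x‖ ^ 2) volume m a := (hgc.norm.pow 2).intervalIntegrable _ _
  have iNA' : IntervalIntegrable (fun x ↦ ‖g (x - L)‖ ^ 2) volume m a := (hgL.norm.pow 2).intervalIntegrable _ _
  have hYsum : Yp + Ym = 2 * (NA + NA') := by
    rw [hYp, hYm, ← intervalIntegral.integral_add iYp iYm, hNA, hNA',
      ← intervalIntegral.integral_add iNA iNA', ← intervalIntegral.integral_const_mul]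
    refine intervalIntegral.integral_congr fun x _ ↦ ?_
    simp only [hΨp, hΨm]
    exact normSq_reflectPair_add hω _ _
  have hYdiff : Yp - Ym = 4 * KA := by
    rw [hYp, hYm, ← intervalIntegral.integral_sub iYp iYm, hKA, ← intervalIntegral.integral_const_mul]
    refine intervalIntegral.integral_congr fun x _ ↦ ?_
    simp only [hΨp, hΨm]
    exact normSq_reflectPair_sub _ _ _
  -- `KA = Re(ω k(L))`
  have hKAk : KA = (ω * weilConv g (weilReflect g) L).re := by
    have hcs : HasCompactSupport fun x ↦ ω * (g x * conj (g (x - L))) :=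
      (hg.2.mul_right (f' := fun x ↦ conj (g (x - L)))).mul_left
    have hInt : Integrable fun x ↦ ω * (g x * conj (g (x - L))) :=
      (by fun_prop : Continuous fun x ↦ ω * (g x * conj (g (x - L)))).integrable_of_hasCompactSupport hcs
    have hre := integral_re hInt
    simp only [RCLike.re_to_complex] at hre
    rw [weilConv_weilReflect_apply_eq, ← integral_const_mul, ← hre, hKA]
    refine (integral_eq_intervalIntegral_of_zero_off hma' fun x hx ↦ ?_).symm
    rw [mem_Icc, not_and_or, not_le, not_le] at hx
    rcases hx with hx | hx
    · have : g (x - L) = 0 := hz _ fun h ↦ by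
        rw [mem_Icc] at h
        have : L - a = m := by rw [hm]
        linarith [h.1]
      simp [this]
    · have : g x = 0 := hz _ fun h ↦ by
        rw [mem_Icc] at h
        linarith [h.2]
      simp [this]
  -- `Ep = 2 (CA' + Re ω IA')`, `Em = 2 (CA' - Re ω IA')`
  set CA' : ℝ := ∫ x in m..a, Real.cosh (x / 2) ^ 2 with hCA'
  set IA' : ℝ := ∫ x in m..a, Real.cosh (x / 2) * Real.cosh ((L - x) / 2) with hIA'
  have hCA'σ : ∫ x in m..a, Real.cosh ((L - x) / 2) ^ 2 = CA' := by
    have e1 := intervalIntegral.integral_comp_sub_left (fun y ↦ Real.cosh (y / 2) ^ 2) L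
      (a := m) (b := a)
    rw [show L - a = m by rw [hm], show L - m = a by rw [hm]; ring] at e1
    rw [hCA', ← e1]
  have hE : Ep = 2 * CA' + 2 * ω.re * IA' ∧ Em = 2 * CA' - 2 * ω.re * IA' := by
    have ic : IntervalIntegrable (fun x ↦ Real.cosh (x / 2) ^ 2) volume m a :=
      (by fun_prop : Continuous fun x ↦ Real.cosh (x / 2) ^ 2).intervalIntegrable _ _
    have icσ : IntervalIntegrable (fun x ↦ Real.cosh ((L - x) / 2) ^ 2) volume m a :=
      (by fun_prop : Continuous fun x ↦ Real.cosh ((L - x) / 2) ^ 2).intervalIntegrable _ _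
    have ii : IntervalIntegrable (fun x ↦ 2 * ω.re * Real.cosh (x / 2) * Real.cosh ((L - x) / 2))
        volume m a :=
      (by fun_prop : Continuous fun x ↦
        2 * ω.re * Real.cosh (x / 2) * Real.cosh ((L - x) / 2)).intervalIntegrable _ _
    have hI2 : ∫ x in m..a, 2 * ω.re * Real.cosh (x / 2) * Real.cosh ((L - x) / 2) =
        2 * ω.re * IA' := by
      rw [hIA', ← intervalIntegral.integral_const_mul]
      refine intervalIntegral.integral_congr fun x _ ↦ ?_
      ring
    constructor
    · have : Ep = ∫ x in m..a, (Real.cosh (x / 2) ^ 2 + Real.cosh ((L - x) / 2) ^ 2 +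
          2 * ω.re * Real.cosh (x / 2) * Real.cosh ((L - x) / 2)) := by
        rw [hEp]
        refine intervalIntegral.integral_congr fun x _ ↦ ?_
        simp only [hηp]
        exact (normSq_conj_mul_add_real hω _ _).1
      rw [this, intervalIntegral.integral_add (ic.add icσ) ii, intervalIntegral.integral_add ic icσ,
        hCA'σ, hI2]
      ring
    · have : Em = ∫ x in m..a, (Real.cosh (x / 2) ^ 2 + Real.cosh ((L - x) / 2) ^ 2 -
          2 * ω.re * Real.cosh (x / 2) * Real.cosh ((L - x) / 2)) := by
        rw [hEm]
        refine intervalIntegral.integral_congr fun x _ ↦ ?_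
        simp only [hηm]
        exact (normSq_conj_mul_add_real hω _ _).2
      rw [this, intervalIntegral.integral_sub (ic.add icσ) ii, intervalIntegral.integral_add ic icσ,
        hCA'σ, hI2]
      ring
  -- closed forms
  have hCMc : CM' = CM := by rw [hCM', integral_cosh_half_sq, hCM, Real.sinh_neg]; ring
  have hCAc : CA' = CA := by rw [hCA', integral_cosh_half_sq, hCA]; ring
  have hIAc : IA' = IA := by
    rw [hIA', integral_cosh_half_mul_cosh_half_sub, hIA,
      show m - L / 2 = -(a - L / 2) by rw [hm]; ring, Real.sinh_neg]
    ring
  -- assemble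
  have hWeq : W = B * (∫ x, ‖g x‖ ^ 2) - δ * (NA + NA') +
      2 * κ * (ω * weilConv g (weilReflect g) L).re := by
    have h1 : W = B * NM + B' / 2 * (Yp + Ym) + κ / 2 * (Yp - Ym) := by rw [hW]; ring
    rw [h1, hYsum, hYdiff, hKAk, hN, hB']; ring
  have hGeq : G = CM / B + (CA + ω.re * IA) / (B - δ + κ) + (CA - ω.re * IA) / (B - δ - κ) := by
    rw [hG, hE.1, hE.2, hCMc, hCAc, hIAc, hB']
    ring
  refine ⟨NA + NA', hk3, ?_, ?_⟩
  · rw [← hWeq]; exact hW0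
  · rw [← hWeq, ← hGeq]; exact hsq

end Summit.Ventures.WeilGRH
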